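import Summits.Ventures.Crystal3D.Theorems.StickyWulffConstantCoaxialWallLawAutomaton
import HarnessLib

/-!
# The line automaton of the co-axial cell: ends = starts, and every grain line that leaves the sample ends

HONEST FRAMING. Part of the venture `Summits/Ventures/Crystal3D` (cell `crystal3d-full`), helper for the
crux `CoaxialWallLaw` (stmt-Ventures-19481) of `route-Ventures-StickyWulffConstant`, REGISTERED line
`WallLedgerF` (planner cf-p1 gen 16), open stub `stub_coaxialTwoSlabAdhesion` (general fillings).  Brick 3 of
the FLUX-GAP architecture (memo F-FLUXGAP-ARCH §2): the GLOBAL COUNT of the automaton of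
`…CoaxialWallLawAutomaton`, by pure finite counting — no paths, no acyclicity, no reachability.  Rung credit
only; F-C1 not moved.

THE COUNT.  States `v = (b, c)`; the state space `V` (given by a membership `iff`): `b ∈ X`,
`zlo ≤ b₂ < zcut`, `b ∉ P′` (the inner bottom sample), the invariant `Inv c b`, and some NEGATIVE slot of
class `c` occupied at `b` (this excludes inverted terraces).  The move `f` (slot step at a full shell, capper
step otherwise) is injective on `{Full ∨ TD}` (`move_injOn`); let `D′ = {v ∈ V : (Full ∨ TD) ∧ f v ∈ V}`.

* `card_sdiff_eq_card_sdiff_image` — for an injective partial self-map of a finite set, the complement of the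
  domain and the complement of the image have the same size: **#ENDS = #STARTS**.
* `move_target` — closure: from `v ∈ V` with `Full ∨ TD` the target `f v` is a ball of `X` above `zlo`, off `P′`,
  carries the invariant of its class and an occupied negative slot, and RISES; so `f v ∉ V` only when the
  target has reached the cut `zcut` (a TRANSMITTED end).
* `start_of_top` — every ball `p ∈ P′` with a full class-`false` shell whose designated successor has left the
  window upwards (`zlo < (p + dsg p)₂ < zcut`) yields the START `(p + dsg p, false) ∈ V \ f(D′)` (its only
  possible predecessor ball is `p ∈ P′`), injectively in `p`.
* `card_tops_le_card_ends` — **the count**: the number of such tops is at most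
  `#{v ∈ V : ¬Full ∧ ¬TD} + #{v ∈ V : (Full ∨ TD) ∧ zcut ≤ (f v)₂}` — free ends plus transmitted ends.

WHAT THIS IS NOT: the free ends are paid (`line_step`) or foreign twin dozens, and the transmitted ends sit
in the shallow band — next files; not the stub; F-C1 not moved.
-/

noncomputable section

namespace Summit.Ventures.Crystal3D.Theorems

open Summit.Ventures.Crystal3D Finset
open Literature.MathematicalPhysics.StatisticalMechanics (fccStacking)
open scoped InnerProductSpace

/-! ### Ends = starts -/

/-- **Ends = starts.**  If `g` is injective on `D ⊆ V` and maps `D` into `V`, then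
`#(V \ D) = #(V \ g(D))`. -/
theorem card_sdiff_eq_card_sdiff_image {α : Type*} [DecidableEq α] (V D : Finset α) (g : α → α)
    (hDV : D ⊆ V) (hinj : Set.InjOn g D) (himg : D.image g ⊆ V) :
    (V \ D).card = (V \ D.image g).card := by
  have h1 := Finset.card_sdiff_add_card_eq_card hDV
  have h2 := Finset.card_sdiff_add_card_eq_card himg
  have h3 : (D.image g).card = D.card := Finset.card_image_of_injOn hinj
  omega

section Count

open scoped Classical

variable {X P' : Finset (EuclideanSpace ℝ (Fin 3))} {V : Finset (EuclideanSpace ℝ (Fin 3) × Bool)}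
  {F : Bool → (EuclideanSpace ℝ (Fin 3) ≃ₗᵢ[ℝ] EuclideanSpace ℝ (Fin 3))} {m : EuclideanSpace ℝ (Fin 3)}
  {dsg : Bool → EuclideanSpace ℝ (Fin 3) → EuclideanSpace ℝ (Fin 3)}
  {f : EuclideanSpace ℝ (Fin 3) × Bool → EuclideanSpace ℝ (Fin 3) × Bool}
  {Full TD Inv : Bool → EuclideanSpace ℝ (Fin 3) → Prop} {zlo zcut : ℝ}

/-- The predecessor ball of a target: if `f v = (s, c)` then `v.1 = s − dsg c s`. -/
theorem move_ball_eq
    (hdsg_up : ∀ c b, ∃ u ∈ fccSlots, ⟪F c u, m⟫_ℝ = Real.sqrt (2 / 3) ∧ dsg c b = F c u)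
    (hdsg_inv : ∀ c b, ∀ w ∈ fccStacking 1 (Real.sqrt (2 / 3)), dsg c (b + F c w) = dsg c b)
    (hf : ∀ v, f v = if Full v.2 v.1 then (v.1 + dsg v.2 v.1, v.2) else (v.1 + dsg (!v.2) v.1, !v.2))
    {v : EuclideanSpace ℝ (Fin 3) × Bool} {s : EuclideanSpace ℝ (Fin 3)} {c : Bool} (h : f v = (s, c)) :
    v.1 = s - dsg c s := by
  rw [hf] at h
  by_cases hF : Full v.2 v.1
  · rw [if_pos hF] at h
    obtain ⟨h1, h2⟩ := Prod.mk.inj h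
    subst h2
    obtain ⟨u, hu, -, hde⟩ := hdsg_up v.2 v.1
    have : dsg v.2 s = dsg v.2 v.1 := by
      have e := hdsg_inv v.2 v.1 u (mem_fcc_of_mem_fccSlots hu)
      rw [← hde, h1] at e; exact e
    rw [this, ← h1, add_sub_cancel_right]
  · rw [if_neg hF] at h
    obtain ⟨h1, h2⟩ := Prod.mk.inj h
    subst h2
    obtain ⟨u, hu, -, hde⟩ := hdsg_up (!v.2) v.1
    have : dsg (!v.2) s = dsg (!v.2) v.1 := by
      have e := hdsg_inv (!v.2) v.1 u (mem_fcc_of_mem_fccSlots hu)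
      rw [← hde, h1] at e; exact e
    rw [this, ← h1, add_sub_cancel_right]

/-- **Closure of the move.**  From `v = (b, c) ∈ V` with `Full c b ∨ TD c b` the target `f v = (s, c')`
satisfies: `s ∈ X`, `b₂ < s₂` (so `zlo < s₂` and `s ∉ P′`), `Inv c' s`, and the negative slot `−dsg c' s` of
class `c'` is occupied at `s` (by `b`).  Hence `f v ∈ V` unless `zcut ≤ s₂`. -/
theorem move_target (hm : ‖m‖ = 1)
    (hmenu : ∀ c, ∀ w ∈ fccSlots,
      ⟪F c w, m⟫_ℝ = 0 ∨ ⟪F c w, m⟫_ℝ = Real.sqrt (2 / 3) ∨ ⟪F c w, m⟫_ℝ = -Real.sqrt (2 / 3))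
    (hmir : ∀ c, ∀ w ∈ fccSlots, ∃ w' ∈ fccSlots, F (!c) w' = F c w - (2 * ⟪F c w, m⟫_ℝ) • m)
    (hFull : ∀ c b, Full c b ↔ ∀ w ∈ fccSlots, b + F c w ∈ X)
    (hTD : ∀ c b, TD c b ↔
      ((∀ w ∈ fccSlots, ⟪F c w, m⟫_ℝ ≤ 0 → b + F c w ∈ X) ∧
       (∀ w ∈ fccSlots, ⟪F c w, m⟫_ℝ < 0 → b + (F c w - (2 * ⟪F c w, m⟫_ℝ) • m) ∈ X) ∧
       (∀ w ∈ fccSlots, 0 < ⟪F c w, m⟫_ℝ → b + F c w ∉ X)))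
    (hInv : ∀ c b, Inv c b ↔ ∃ a ∈ fccSlots, ∃ a' ∈ fccSlots, ∃ a'' ∈ fccSlots,
      LinearIndependent ℝ ![a, a', a''] ∧ b + F c a ∈ X ∧ b + F c a' ∈ X ∧ b + F c a'' ∈ X)
    (hdsg_up : ∀ c b, ∃ u ∈ fccSlots, ⟪F c u, m⟫_ℝ = Real.sqrt (2 / 3) ∧ dsg c b = F c u)
    (hdsg_inv : ∀ c b, ∀ w ∈ fccStacking 1 (Real.sqrt (2 / 3)), dsg c (b + F c w) = dsg c b)
    (hrise : ∀ c b, 0 < dsg c b 2)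
    (hf : ∀ v, f v = if Full v.2 v.1 then (v.1 + dsg v.2 v.1, v.2) else (v.1 + dsg (!v.2) v.1, !v.2))
    (hV : ∀ v, v ∈ V ↔ (v.1 ∈ X ∧ zlo ≤ v.1 2 ∧ v.1 2 < zcut ∧ v.1 ∉ P' ∧ Inv v.2 v.1 ∧
      ∃ w ∈ fccSlots, ⟪F v.2 w, m⟫_ℝ < 0 ∧ v.1 + F v.2 w ∈ X))
    (hP' : ∀ p ∈ P', p 2 ≤ zlo)
    {v : EuclideanSpace ℝ (Fin 3) × Bool} (hv : v ∈ V) (hmove : Full v.2 v.1 ∨ TD v.2 v.1) :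
    (f v).1 ∈ X ∧ v.1 2 < (f v).1 2 ∧ Inv (f v).2 (f v).1 ∧
      (∃ w ∈ fccSlots, ⟪F (f v).2 w, m⟫_ℝ < 0 ∧ (f v).1 + F (f v).2 w ∈ X) ∧
      (f v ∉ V → zcut ≤ (f v).1 2) := by
  have hr : 0 < Real.sqrt (2 / 3) := Real.sqrt_pos.2 (by norm_num)
  obtain ⟨hbX, hzlo, -, -, -, -⟩ := (hV v).1 hv
  -- the target and its class
  obtain ⟨s, c', hsc, hsX, hInvs⟩ : ∃ s c', f v = (s, c') ∧ s ∈ X ∧ Inv c' s := by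
    by_cases hF : Full v.2 v.1
    · refine ⟨v.1 + dsg v.2 v.1, v.2, by rw [hf, if_pos hF], ?_, inv_full_step hFull hInv hdsg_up hbX hF⟩
      obtain ⟨u, hu, -, hde⟩ := hdsg_up v.2 v.1
      rw [hde]; exact (hFull _ _).1 hF u hu
    · have hT : TD v.2 v.1 := hmove.resolve_left hF
      exact ⟨v.1 + dsg (!v.2) v.1, !v.2, by rw [hf, if_neg hF], cap_target_mem hm hmir hTD hdsg_up hT,
        inv_cap_step hm hmenu hmir hTD hInv hdsg_up hbX hT⟩
  have hball : v.1 = s - dsg c' s := move_ball_eq hdsg_up hdsg_inv hf hsc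
  have hs : s = v.1 + dsg c' s := by rw [hball, sub_add_cancel]
  rw [hsc]
  simp only
  -- rise
  have hlt : v.1 2 < s 2 := by
    have := hrise c' s
    rw [hs, PiLp.add_apply]; linarith
  -- occupied negative slot `−u` where `dsg c' s = F c' u`
  obtain ⟨u, hu, hun, hde⟩ := hdsg_up c' s
  have hneg : ∃ w ∈ fccSlots, ⟪F c' w, m⟫_ℝ < 0 ∧ s + F c' w ∈ X := by
    refine ⟨-u, neg_mem_fccSlots hu, ?_, ?_⟩
    · rw [map_neg, inner_neg_left, hun]; linarith
    · rw [map_neg, ← hde, ← sub_eq_add_neg, ← hball]; exact hbX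
  refine ⟨hsX, hlt, hInvs, hneg, fun hnot => ?_⟩
  by_contra hcut
  push Not at hcut
  apply hnot
  rw [hV]
  refine ⟨hsX, by linarith, hcut, fun hsP => ?_, hInvs, hneg⟩
  have := hP' s hsP
  linarith

/-- **Starts from tops.**  A ball `p ∈ P′ ⊆ X` with the full class-`false` shell whose designated successor
`p + dsg false p` lies in the height range `(zlo, zcut)` gives the state `(p + dsg false p, false) ∈ V`
outside the image `f(D′)` of `D′ = {v ∈ V : (Full ∨ TD) ∧ f v ∈ V}`. -/
theorem start_of_top
    (hFull : ∀ c b, Full c b ↔ ∀ w ∈ fccSlots, b + F c w ∈ X)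
    (hInv : ∀ c b, Inv c b ↔ ∃ a ∈ fccSlots, ∃ a' ∈ fccSlots, ∃ a'' ∈ fccSlots,
      LinearIndependent ℝ ![a, a', a''] ∧ b + F c a ∈ X ∧ b + F c a' ∈ X ∧ b + F c a'' ∈ X)
    (hdsg_up : ∀ c b, ∃ u ∈ fccSlots, ⟪F c u, m⟫_ℝ = Real.sqrt (2 / 3) ∧ dsg c b = F c u)
    (hdsg_inv : ∀ c b, ∀ w ∈ fccStacking 1 (Real.sqrt (2 / 3)), dsg c (b + F c w) = dsg c b)
    (hf : ∀ v, f v = if Full v.2 v.1 then (v.1 + dsg v.2 v.1, v.2) else (v.1 + dsg (!v.2) v.1, !v.2))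
    (hV : ∀ v, v ∈ V ↔ (v.1 ∈ X ∧ zlo ≤ v.1 2 ∧ v.1 2 < zcut ∧ v.1 ∉ P' ∧ Inv v.2 v.1 ∧
      ∃ w ∈ fccSlots, ⟪F v.2 w, m⟫_ℝ < 0 ∧ v.1 + F v.2 w ∈ X))
    (hP'X : P' ⊆ X) (hP' : ∀ p ∈ P', p 2 ≤ zlo)
    {p : EuclideanSpace ℝ (Fin 3)} (hp : p ∈ P') (hfull : Full false p)
    (hlo : zlo < (p + dsg false p) 2) (hhi : (p + dsg false p) 2 < zcut) :
    (p + dsg false p, false) ∈ V ∧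
      ∀ v ∈ V, (Full v.2 v.1 ∨ TD v.2 v.1) → f v ≠ (p + dsg false p, false) := by
  have hr : 0 < Real.sqrt (2 / 3) := Real.sqrt_pos.2 (by norm_num)
  have hpX : p ∈ X := hP'X hp
  obtain ⟨u, hu, hun, hde⟩ := hdsg_up false p
  constructor
  · rw [hV]
    refine ⟨?_, hlo.le, hhi, fun hP => ?_, inv_full_step hFull hInv hdsg_up hpX hfull, ?_⟩
    · rw [hde]; exact (hFull _ _).1 hfull u hu
    · have := hP' _ hP; linarith
    · refine ⟨-u, neg_mem_fccSlots hu, ?_, ?_⟩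
      · rw [map_neg, inner_neg_left, hun]; linarith
      · rw [map_neg, hde, add_neg_cancel_right]; exact hpX
  · intro v hv _ hfv
    have hball := move_ball_eq hdsg_up hdsg_inv hf hfv
    have hinv : dsg false (p + dsg false p) = dsg false p := by
      conv_lhs => rw [hde]
      exact hdsg_inv false p u (mem_fcc_of_mem_fccSlots hu)
    rw [hinv, add_sub_cancel_right] at hball
    have hvP : v.1 ∉ P' := ((hV v).1 hv).2.2.2.1
    exact hvP (hball ▸ hp)

/-- **The count: tops ≤ free ends + transmitted ends.**  See the module docstring. -/
theorem card_tops_le_card_ends (hX : ∀ p ∈ X, ∀ q ∈ X, p ≠ q → 1 ≤ dist p q) (hm : ‖m‖ = 1)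
    (hmenu : ∀ c, ∀ w ∈ fccSlots,
      ⟪F c w, m⟫_ℝ = 0 ∨ ⟪F c w, m⟫_ℝ = Real.sqrt (2 / 3) ∨ ⟪F c w, m⟫_ℝ = -Real.sqrt (2 / 3))
    (hmir : ∀ c, ∀ w ∈ fccSlots, ∃ w' ∈ fccSlots, F (!c) w' = F c w - (2 * ⟪F c w, m⟫_ℝ) • m)
    (hFull : ∀ c b, Full c b ↔ ∀ w ∈ fccSlots, b + F c w ∈ X)
    (hTD : ∀ c b, TD c b ↔
      ((∀ w ∈ fccSlots, ⟪F c w, m⟫_ℝ ≤ 0 → b + F c w ∈ X) ∧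
       (∀ w ∈ fccSlots, ⟪F c w, m⟫_ℝ < 0 → b + (F c w - (2 * ⟪F c w, m⟫_ℝ) • m) ∈ X) ∧
       (∀ w ∈ fccSlots, 0 < ⟪F c w, m⟫_ℝ → b + F c w ∉ X)))
    (hInv : ∀ c b, Inv c b ↔ ∃ a ∈ fccSlots, ∃ a' ∈ fccSlots, ∃ a'' ∈ fccSlots,
      LinearIndependent ℝ ![a, a', a''] ∧ b + F c a ∈ X ∧ b + F c a' ∈ X ∧ b + F c a'' ∈ X)
    (hdsg_up : ∀ c b, ∃ u ∈ fccSlots, ⟪F c u, m⟫_ℝ = Real.sqrt (2 / 3) ∧ dsg c b = F c u)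
    (hdsg_inv : ∀ c b, ∀ w ∈ fccStacking 1 (Real.sqrt (2 / 3)), dsg c (b + F c w) = dsg c b)
    (hrise : ∀ c b, 0 < dsg c b 2)
    (hf : ∀ v, f v = if Full v.2 v.1 then (v.1 + dsg v.2 v.1, v.2) else (v.1 + dsg (!v.2) v.1, !v.2))
    (hV : ∀ v, v ∈ V ↔ (v.1 ∈ X ∧ zlo ≤ v.1 2 ∧ v.1 2 < zcut ∧ v.1 ∉ P' ∧ Inv v.2 v.1 ∧
      ∃ w ∈ fccSlots, ⟪F v.2 w, m⟫_ℝ < 0 ∧ v.1 + F v.2 w ∈ X))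
    (hP'X : P' ⊆ X) (hP' : ∀ p ∈ P', p 2 ≤ zlo) :
    (P'.filter fun p => Full false p ∧ zlo < (p + dsg false p) 2 ∧ (p + dsg false p) 2 < zcut).card ≤
      (V.filter fun v => ¬ Full v.2 v.1 ∧ ¬ TD v.2 v.1).card +
        (V.filter fun v => (Full v.2 v.1 ∨ TD v.2 v.1) ∧ zcut ≤ (f v).1 2).card := by
  -- the domain `D'` and the two complements
  set D' : Finset (EuclideanSpace ℝ (Fin 3) × Bool) :=
    V.filter fun v => (Full v.2 v.1 ∨ TD v.2 v.1) ∧ f v ∈ V with hD'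
  have hD'V : D' ⊆ V := filter_subset _ _
  have hinj : Set.InjOn f D' := by
    have hfe : f = fun v : EuclideanSpace ℝ (Fin 3) × Bool =>
        if Full v.2 v.1 then (v.1 + dsg v.2 v.1, v.2) else (v.1 + dsg (!v.2) v.1, !v.2) := funext hf
    rw [hfe]
    refine (move_injOn hX hm hmenu hmir hFull hTD hdsg_up hdsg_inv).mono ?_
    intro v hv
    rw [Finset.mem_coe, hD', mem_filter] at hv
    exact hv.2.1
  have himg : D'.image f ⊆ V := by
    intro w hw
    obtain ⟨v, hv, rfl⟩ := mem_image.1 hw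
    rw [hD', mem_filter] at hv
    exact hv.2.2
  have hends := card_sdiff_eq_card_sdiff_image V D' f hD'V hinj himg
  -- starts: the tops inject into `V \ image`
  set Tops := P'.filter fun p => Full false p ∧ zlo < (p + dsg false p) 2 ∧ (p + dsg false p) 2 < zcut
    with hTops
  have hstart : Tops.card ≤ (V \ D'.image f).card := by
    refine Finset.card_le_card_of_injOn (fun p => (p + dsg false p, false)) ?_ ?_
    · intro p hp
      rw [Finset.mem_coe, hTops, mem_filter] at hp
      obtain ⟨hpP, hfull, hlo, hhi⟩ := hp
      obtain ⟨hmem, hno⟩ := start_of_top hFull hInv hdsg_up hdsg_inv hf hV hP'X hP' hpP hfull hlo hhi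
      rw [Finset.mem_coe, mem_sdiff]
      refine ⟨hmem, fun him => ?_⟩
      obtain ⟨v, hv, hfv⟩ := mem_image.1 him
      rw [hD', mem_filter] at hv
      exact hno v hv.1 hv.2.1 hfv
    · intro p _ p' _ h
      simp only [Prod.mk.injEq, and_true] at h
      exact dsg_cancel hdsg_up hdsg_inv h
  -- ends: `V \ D'` splits into free ends and transmitted ends
  have hsplit : V \ D' ⊆ (V.filter fun v => ¬ Full v.2 v.1 ∧ ¬ TD v.2 v.1) ∪
      (V.filter fun v => (Full v.2 v.1 ∨ TD v.2 v.1) ∧ zcut ≤ (f v).1 2) := by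
    intro v hv
    rw [mem_sdiff] at hv
    obtain ⟨hvV, hvD⟩ := hv
    rw [mem_union, mem_filter, mem_filter]
    by_cases hmove : Full v.2 v.1 ∨ TD v.2 v.1
    · right
      refine ⟨hvV, hmove, ?_⟩
      have hcl := move_target hm hmenu hmir hFull hTD hInv hdsg_up hdsg_inv hrise hf hV hP' hvV hmove
      apply hcl.2.2.2.2
      intro hfV
      exact hvD (by rw [hD', mem_filter]; exact ⟨hvV, hmove, hfV⟩)
    · left
      push Not at hmove
      exact ⟨hvV, hmove.1, hmove.2⟩
  calc Tops.card ≤ (V \ D'.image f).card := hstart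
    _ = (V \ D').card := hends.symm
    _ ≤ _ := (card_le_card hsplit).trans (card_union_le _ _)

end Count

end Summit.Ventures.Crystal3D.Theorems

end
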